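import Mathlib
import Summits.CriticalPhenomena.CardyFormulaZ2.Theorems.CardyMagicRigidityNestingRigidityBondDuality
import Summits.CriticalPhenomena.CardyFormulaZ2.Theorems.CardyMagicRigidityNestingRigidityTowerCountMeasurable
import Literature.Probability.Percolation.BondPercolationSymmetry
import HarnessLib

/-!
# Crux `NestingRigidity`, line `ring-cloud-tomography` (r5): lattice translations act on the typed
# loop representation of bond-`ℤ²` by translating the loops, and preserve `P_{1/2}`

Crux `Summit.CriticalPhenomena.CardyFormulaZ2.Theses.CardyMagicRigidity.NestingRigidity`
(stmt-CriticalPhenomena-4835), line `ring-cloud-tomography`, stub R1'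
`stub_uvDecoupling : ∀ E ∈ latticeEnsembles, UVDecoupling E` — the SYMMETRY layer of the
first-moment identity behind hypothesis (L) of `uvDecoupling_of_tilted_moments` on `ℤ²` (exact on
`𝕋`: `integral_finsum_nestingPhase_sdiff_tower_tEns`; on `ℤ²` the centring of the cone phases needs
these translations, the point reflections and self-duality of the bond loop representation).
Everything is configuration-by-configuration and exact, no cited fact, no definition:

* §0–§1 (§0 adapted from crux `EdgePrecompact`) corners, medial turns and INTERFACE LOOPS transport
  along the translations `τ_w = sym2Equiv (Site.shift w)` (`isInterfaceLoop_map_of_turn`, the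
  forward twin of `isInterfaceLoop_map_reverse`; `isInterfaceLoop_map_shift`, `…_of_map_shift`);
* §2 the drawn loop of the translated dart list is the translated drawn loop
  (`loopCurve_map_shift`), the shoelace type is unchanged (`loopType_map_shift`);
* §3 EQUIVARIANCE (registered anchor `bondLoopConfig_relabel_shift`):
  `bondLoopConfig δ 0 (ω + w) = (bondLoopConfig δ 0 ω) + δw` as TYPED configurations
  (`LoopConfig.map` along `z ↦ z + δw`), hence for the loop sets of `zEns`;
* §4 `ω ↦ ω + w` preserves `zEns.P = P_{1/2}` (`bondPercolation_map_shift`), so **the law of the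
  loop set of `zEns` is invariant under `u ↦ u + δw`, `w ∈ ℤ²`**:
  `∫ G((· + δw) '' loops) dP = ∫ G(loops) dP` for EVERY real statistic `G`
  (`integral_comp_translate_loops_zEns`);
* §5 tower counts and dipole counts `#{u : W(u,x) ≠ 0, W(u,y) = 0}` at translated centres have the
  same expectations (`integral_comp_towerCount_translate_zEns`, `integral_ncard_dipole_translate_zEns`).
-/

noncomputable section

open MeasureTheory Set Filter Metric
open scoped Real Topology BigOperators

namespace Summit.CriticalPhenomena.CardyFormulaZ2.Cruxes.NestingRigidity.RingCloudTomography

open Literature.Probability.RandomPlanarGeometry Literature.Probability.Percolation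
  Literature.Probability.LatticeModels
open Summit.CriticalPhenomena.CardyFormulaZ2.Cruxes.NestingRigidity.MarkovCascadeOneGeneration
  (continuous_translate isometry_translate wind_map_translate range_map_translate
    map_translate_map_translate_neg)

namespace BondTranslation

/-- The translation `z ↦ z + b` of the plane as a continuous map (local notation, not a
definition; the affine form `1 * z + b` of `CurveClass.wind_map_affine`). -/
local notation3 "T[" b "]" => (⟨fun z : ℂ ↦ 1 * z + (b : ℂ), continuous_translate b⟩ : C(ℂ, ℂ))

/-- The lattice translation by `w ∈ ℤ²` acting on medial vertices (local notation). -/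
local notation3 "τ[" w "]" => sym2Equiv (Site.shift (w : Site 2))

/-! ## §0 Translations on sites, corners, medial vertices and configurations (adapted from crux
`EdgePrecompact`'s `…MedialExplorationShiftData` / `…TranslationCovariance`, re-proved to avoid a
dependency on another crux's definitions module) -/

section Sites

variable (v f w : Site 2)

-- §0 is adapted from CardyComplexConeEdgePrecompactMedialExplorationShiftData /
-- CardyComplexConeEdgePrecompactTranslationCovariance (crux EdgePrecompact), trimmed to what §1–§2 use.
/-- `cornerEdge` commutes with translations (corners and reflected neighbours translate rigidly). -/
theorem cornerEdge_add (i : Fin 2) : cornerEdge (v + w) (f + w) i = τ[w] (cornerEdge v f i) := by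
  have h : cornerNeighbor (v + w) (f + w) i = cornerNeighbor v f i + w := by
    ext j
    by_cases hj : j = i
    · subst hj; simp only [cornerNeighbor, Function.update_self, Pi.add_apply]; ring
    · simp only [cornerNeighbor, Function.update_of_ne hj, Pi.add_apply]
  rw [cornerEdge, cornerEdge, h, sym2Equiv_mk, Site.shift_apply, Site.shift_apply]

/-- `cornerSource` and `cornerTarget` commute with translations (the diagonal test is invariant). -/
theorem cornerSource_add_and :
    cornerSource (v + w) (f + w) = τ[w] (cornerSource v f) ∧ cornerTarget (v + w) (f + w) = τ[w] (cornerTarget v f) := by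
  have hd : (v + w) 0 - (f + w) 0 = (v + w) 1 - (f + w) 1 ↔ v 0 - f 0 = v 1 - f 1 := by
    simp only [Pi.add_apply]; omega
  simp only [cornerSource, cornerTarget, hd, cornerEdge_add, apply_ite (sym2Equiv (Site.shift w)), and_self]

/-- Translations preserve the edges of `ℤ²`. -/
theorem shift_mem_edgeSet_iff (e : Sym2 (Site 2)) : τ[w] e ∈ (zdGraph 2).edgeSet ↔ e ∈ (zdGraph 2).edgeSet :=
  sym2Equiv_mem_edgeSet_iff (G := zdGraph 2) (G' := zdGraph 2)
    { toEquiv := Site.shift w, map_rel_iff' := fun {a b} ↦ zdGraph_adj_shift_iff w a b } e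

/-- `dualEdge` commutes with translations. -/
theorem dualEdge_shift (e : Sym2 (Site 2)) : dualEdge (τ[w] e) = τ[w] (dualEdge e) := by
  induction e using Sym2.ind with
  | h x y =>
    rw [sym2Equiv_mk, Site.shift_apply, Site.shift_apply]
    simp only [dualEdge, Sym2.lift_mk, ← sup_add, ← inf_add, add_right_comm _ w, add_left_inj]
    split_ifs <;> simp only [sym2Equiv_mk, Site.shift_apply, add_sub_right_comm]

/-- `τ_w z ∈ ω + w ↔ z ∈ ω`. -/
theorem shift_mem_relabel_shift_iff (ω : BondConfig (Site 2)) (z : Sym2 (Site 2)) :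
    τ[w] z ∈ BondConfig.relabel τ[w] ω ↔ z ∈ ω := by
  rw [BondConfig.mem_relabel_iff, Equiv.symm_apply_apply]

/-- Translating by `w` and then by `−w` restores the configuration. -/
theorem relabel_shift_neg_relabel_shift (ω : BondConfig (Site 2)) :
    BondConfig.relabel τ[-w] (BondConfig.relabel τ[w] ω) = ω := by
  have hneg : τ[-w] = (τ[w]).symm := by
    rw [sym2Equiv_symm, show Site.shift (-w) = (Site.shift w).symm from Equiv.ext fun x ↦ by simp [sub_eq_add_neg]]
  ext z
  rw [hneg, BondConfig.mem_relabel_iff, Equiv.symm_symm, shift_mem_relabel_shift_iff]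

/-- On dart lists, translating by `w` and then by `−w` is the identity. -/
theorem map_shift_map_shift_neg (γ : List MedialVertex) : (γ.map τ[w]).map τ[-w] = γ := by
  rw [List.map_map]
  convert List.map_id γ
  funext e
  change sym2Equiv (Site.shift (-w)) (sym2Equiv (Site.shift w) e) = e
  induction e using Sym2.ind with
  | h x y => rw [sym2Equiv_mk, sym2Equiv_mk]; simp

/-- The dual configuration of a translated configuration is the translated dual configuration. -/
theorem dualConfig_relabel_shift_eq (ω : BondConfig (Site 2)) :
    dualConfig (BondConfig.relabel τ[w] ω) = BondConfig.relabel τ[w] (dualConfig ω) := by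
  rw [BondConfig.relabel_apply, BondConfig.relabel_apply, dualConfig, dualConfig,
    Set.image_sdiff (sym2Equiv (Site.shift w)).injective, Set.image_image, Set.image_image]
  congr 1
  · ext e
    rw [Set.mem_image_equiv, ← shift_mem_edgeSet_iff w ((τ[w]).symm e), Equiv.apply_symm_apply]
  · congr 1; funext e; exact dualEdge_shift w e

/-- **The turning rule is translation covariant.** -/
theorem isMedialTurn_relabel_iff (ω : BondConfig (Site 2)) (e₀ e₁ e₂ : MedialVertex) :
    IsMedialTurn (BondConfig.relabel τ[w] ω) (τ[w] e₀) (τ[w] e₁) (τ[w] e₂) ↔ IsMedialTurn ω e₀ e₁ e₂ := by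
  have key : dualEdge (τ[w] e₁) ∈ dualConfig (BondConfig.relabel τ[w] ω) ↔ dualEdge e₁ ∈ dualConfig ω := by
    rw [dualEdge_shift, dualConfig_relabel_shift_eq, shift_mem_relabel_shift_iff]
  have inj := (sym2Equiv (Site.shift w)).injective
  have hsub : ∀ x : Site 2, ∃ y, y + w = x := fun x ↦ ⟨x - w, sub_add_cancel x w⟩
  -- being a corner of a face is translation invariant (`isCorner_add_iff` of crux EdgePrecompact)
  have isCorner_add_iff_isCorner : ∀ v f w : Site 2, IsCorner (v + w) (f + w) ↔ IsCorner v f :=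
    fun v f w ↦ forall_congr' fun i ↦ by simp only [Pi.add_apply]; omega
  constructor
  · rintro ⟨v₁', f₁', v₂', f₂', hc₁, hs₁, ht₁, hc₂, hs₂, ht₂, hlast⟩
    obtain ⟨v₁, rfl⟩ := hsub v₁'
    obtain ⟨f₁, rfl⟩ := hsub f₁'
    obtain ⟨v₂, rfl⟩ := hsub v₂'
    obtain ⟨f₂, rfl⟩ := hsub f₂'
    rw [(cornerSource_add_and _ _ w).1] at hs₁ hs₂; rw [(cornerSource_add_and _ _ w).2] at ht₁ ht₂
    rw [isCorner_add_iff_isCorner _ _ w] at hc₁ hc₂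
    rw [add_left_inj, add_left_inj, key, shift_mem_relabel_shift_iff] at hlast
    exact ⟨v₁, f₁, v₂, f₂, hc₁, inj hs₁, inj ht₁, hc₂, inj hs₂, inj ht₂, hlast⟩
  · rintro ⟨v₁, f₁, v₂, f₂, hc₁, rfl, rfl, hc₂, hs₂, rfl, hlast⟩
    exact ⟨v₁ + w, f₁ + w, v₂ + w, f₂ + w, (isCorner_add_iff_isCorner _ _ _).2 hc₁,
      (cornerSource_add_and _ _ _).1, (cornerSource_add_and _ _ _).2, (isCorner_add_iff_isCorner _ _ _).2 hc₂,
      by rw [(cornerSource_add_and _ _ _).1, hs₂], (cornerSource_add_and _ _ _).2,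
      by rwa [add_left_inj, add_left_inj, key, shift_mem_relabel_shift_iff]⟩

/-- The medial point of a translated medial vertex: `medialPoint δ (τ_w e) = medialPoint δ e + δw`. -/
theorem medialPoint_shift (δ : ℝ) (e : MedialVertex) : medialPoint δ (τ[w] e) = medialPoint δ e + meshPoint δ w := by
  have hadd : ∀ x y : Site 2, meshPoint δ (x + y) = meshPoint δ x + meshPoint δ y := fun x y ↦ by
    have h : Site.toComplex (x + y) = Site.toComplex x + Site.toComplex y := Complex.ext (by simp) (by simp)
    rw [meshPoint, meshPoint, meshPoint, h, mul_add]
  induction e using Sym2.ind with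
  | h x y =>
    rw [sym2Equiv_mk, Site.shift_apply, Site.shift_apply, medialPoint_mk, medialPoint_mk, hadd, hadd]
    ring

end Sites

/-! ## §1 Transport of interface loops along lattice translations -/

/-- **Transport of interface loops along an orientation-preserving edge map**: if `φ` is injective
and sends every medial turn of `ω` to a medial turn of `ω'` (in the same order), then `γ.map φ` is
an interface loop of `ω'` for every interface loop `γ` of `ω`. -/
theorem isInterfaceLoop_map_of_turn {ω ω' : BondConfig (Site 2)} {φ : MedialVertex → MedialVertex}
    (hφ : Function.Injective φ)
    (hturn : ∀ {e₀ e₁ e₂ : MedialVertex}, IsMedialTurn ω e₀ e₁ e₂ → IsMedialTurn ω' (φ e₀) (φ e₁) (φ e₂))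
    {γ : List MedialVertex} (h : IsInterfaceLoop ω γ) : IsInterfaceLoop ω' (γ.map φ) := by
  refine ⟨by simpa using h.ne_nil, ?_, fun i hi ↦ ?_⟩
  · rw [← List.map_rotate, List.zip_map]
    exact h.nodup.map (hφ.prodMap hφ)
  · have hi' : i < γ.length := by simpa using hi
    simp only [List.getElem_map, List.length_map]
    exact hturn (h.turn i hi')

/-- **The translate of an interface loop is an interface loop of the translated configuration.** -/
theorem isInterfaceLoop_map_shift (w : Site 2) {ω : BondConfig (Site 2)} {γ : List MedialVertex}
    (h : IsInterfaceLoop ω γ) : IsInterfaceLoop (BondConfig.relabel τ[w] ω) (γ.map τ[w]) :=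
  isInterfaceLoop_map_of_turn (sym2Equiv _).injective (fun ht ↦ (isMedialTurn_relabel_iff w ω _ _ _).2 ht) h

/-- … and conversely (translate back by `−w`). -/
theorem isInterfaceLoop_of_map_shift (w : Site 2) {ω : BondConfig (Site 2)} {γ : List MedialVertex}
    (h : IsInterfaceLoop (BondConfig.relabel τ[w] ω) (γ.map τ[w])) : IsInterfaceLoop ω γ := by
  have h' := isInterfaceLoop_map_shift (-w) h
  rwa [map_shift_map_shift_neg, relabel_shift_neg_relabel_shift] at h'

/-- An interface loop of the translated configuration is the translate of an interface loop. -/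
theorem isInterfaceLoop_map_symm_of_relabel (w : Site 2) {ω : BondConfig (Site 2)} {γ' : List MedialVertex}
    (h : IsInterfaceLoop (BondConfig.relabel τ[w] ω) γ') : IsInterfaceLoop ω (γ'.map (τ[w]).symm) :=
  isInterfaceLoop_of_map_shift w (by rwa [List.map_map, Equiv.self_comp_symm, List.map_id])

/-! ## §2 Geometry: drawn loops and types under translation -/

/-- **The drawn loop of the translated dart list is the translated drawn loop** (mesh `δ`, angle
`0`: medial points move rigidly by `δw`, polylines commute with affine maps). -/
theorem loopCurve_map_shift (δ : ℝ) (w : Site 2) {γ : List MedialVertex} (hγ : γ ≠ []) :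
    loopCurve δ 0 (γ.map τ[w]) = (loopCurve δ 0 γ).map T[meshPoint δ w] := by
  set c : ℂ := meshPoint δ w with hc
  have hl : ((γ.map τ[w]) ++ (γ.map τ[w]).take 1).map (medialPoint δ) =
      ((γ ++ γ.take 1).map (medialPoint δ)).map fun z ↦ 1 * z + c := by
    rw [← List.map_take, ← List.map_append, List.map_map, List.map_map]
    refine List.map_congr_left fun e _ ↦ ?_
    simp only [Function.comp_apply, medialPoint_shift w δ, one_mul, hc]
  rw [loopCurve_zero, loopCurve_zero, hl, CurveClass.map_mk]; congr 1
  set L := (γ ++ γ.take 1).map (medialPoint δ) with hL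
  have hne : L ≠ [] := by simp [hL, hγ]
  obtain ⟨a, l, hal⟩ := List.exists_cons_of_ne_nil hne
  ext t
  change polyline (L.map fun z ↦ 1 * z + c) t = 1 * polyline L t + c
  rw [hal, List.map_cons]
  exact (apply_polylineFrom (fun z : ℂ ↦ 1 * z + c) (fun x y s ↦ by
    simp only [AffineMap.lineMap_apply_module, Complex.real_smul]; push_cast; ring) a l t).symm

/-- The same for unbased loops. -/
theorem unbasedLoop_loopCurve_map_shift (δ : ℝ) (w : Site 2) {γ : List MedialVertex} (hγ : γ ≠ [])
    (h₁ : (loopCurve δ 0 (γ.map τ[w])).IsLoop) (h₂ : (loopCurve δ 0 γ).IsLoop) :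
    UnbasedLoop.mk (BasedLoop.mk (loopCurve δ 0 (γ.map τ[w])) h₁) =
      (UnbasedLoop.mk (BasedLoop.mk (loopCurve δ 0 γ) h₂)).map T[meshPoint δ w]
        (isometry_translate (meshPoint δ w)) := by
  rw [UnbasedLoop.map_mk, BasedLoop.map_mk]
  exact congrArg UnbasedLoop.mk (BasedLoop.mk_eq_mk.2 (loopCurve_map_shift δ w hγ))

/-- Translation does not change the shoelace area of the medial polygon … -/
theorem loopSignedArea_map_shift (w : Site 2) (γ : List MedialVertex) :
    loopSignedArea (γ.map τ[w]) = loopSignedArea γ := by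
  rw [loopSignedArea, loopSignedArea, List.map_map]
  have h : γ.map (medialPoint 1 ∘ τ[w]) = (γ.map (medialPoint 1)).map (meshPoint 1 w + ·) := by
    rw [List.map_map]
    exact List.map_congr_left fun e _ ↦ by simp only [Function.comp_apply, medialPoint_shift w 1, add_comm]
  rw [h, shoelace_map_const_add]

/-- … hence not the orientation type. -/
theorem loopType_map_shift (w : Site 2) (γ : List MedialVertex) : loopType (γ.map τ[w]) = loopType γ := by
  rw [loopType, loopType, loopSignedArea_map_shift]

end BondTranslation

open BondTranslation in
/-- **Lattice translations act on the typed loop representation of bond-`ℤ²` by translating the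
loops** (registered helper toward stub R1' `stub_uvDecoupling`, line `ring-cloud-tomography` r5;
the symmetry layer of the first-moment identity on `ℤ²`).  For every mesh `δ`, lattice vector
`w ∈ ℤ²` and configuration `ω`, the typed loop configuration of the translated configuration
`ω + w = BondConfig.relabel (sym2Equiv (Site.shift w)) ω` is the push-forward of the typed loop
configuration of `ω` along the translation `z ↦ z + δw` of the plane: interface loops translate
(`isInterfaceLoop_map_shift`, `isInterfaceLoop_of_map_shift`), drawn loops translate
(`loopCurve_map_shift`), types are kept (`loopType_map_shift`). -/
theorem bondLoopConfig_relabel_shift : ∀ (δ : ℝ) (w : Site 2) (ω : BondConfig (Site 2)),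
    bondLoopConfig δ 0 (BondConfig.relabel (sym2Equiv (Site.shift w)) ω) =
      (bondLoopConfig δ 0 ω).map ⟨fun z : ℂ ↦ 1 * z + meshPoint δ w, continuous_translate (meshPoint δ w)⟩
        (isometry_translate (meshPoint δ w)) := by
  intro δ w ω; ext i u; simp only [mem_bondLoopConfig_iff, LoopConfig.mem_map_iff]
  constructor
  · rintro ⟨γ', h', ht, rfl⟩
    have h : IsInterfaceLoop ω (γ'.map (sym2Equiv (Site.shift w)).symm) := isInterfaceLoop_map_symm_of_relabel w h'
    have hback : (γ'.map (sym2Equiv (Site.shift w)).symm).map (sym2Equiv (Site.shift w)) = γ' := by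
      rw [List.map_map, Equiv.self_comp_symm, List.map_id]
    refine ⟨_, ⟨_, h, by rw [← loopType_map_shift w, hback, ht], rfl⟩, ?_⟩
    have h₁ : (loopCurve δ 0 ((γ'.map (sym2Equiv (Site.shift w)).symm).map (sym2Equiv (Site.shift w)))).IsLoop := by
      rw [hback]; exact isLoop_loopCurve δ 0 h'.ne_nil
    rw [← unbasedLoop_loopCurve_map_shift δ w h.ne_nil h₁ (isLoop_loopCurve δ 0 h.ne_nil)]
    exact congrArg UnbasedLoop.mk (BasedLoop.mk_eq_mk.2 (by rw [hback]))
  · rintro ⟨_, ⟨γ, h, ht, rfl⟩, rfl⟩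
    exact ⟨γ.map (sym2Equiv (Site.shift w)), isInterfaceLoop_map_shift w h, by rw [loopType_map_shift, ht],
      (unbasedLoop_loopCurve_map_shift δ w h.ne_nil _ (isLoop_loopCurve δ 0 h.ne_nil)).symm⟩

namespace BondTranslation

/-- The translation `z ↦ z + b` of the plane (local notation, re-declared after the anchor). -/
local notation3 "T[" b "]" => (⟨fun z : ℂ ↦ 1 * z + (b : ℂ), continuous_translate b⟩ : C(ℂ, ℂ))

/-- The lattice translation by `w ∈ ℤ²` on medial vertices (local notation, re-declared). -/
local notation3 "τ[" w "]" => sym2Equiv (Site.shift (w : Site 2))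

/-! ## §3 The loop sets of `zEns` under translation -/

/-- The loops (both types) of a pushed-forward configuration are the pushed-forward loops. -/
theorem loops_map {f : C(ℂ, ℂ)} (hf : Isometry f) (c : LoopConfig ℂ) :
    (c.map f hf).loops = UnbasedLoop.map f hf '' c.loops := by
  rw [LoopConfig.loops, LoopConfig.loops, Set.image_union]; rfl

/-- **The loops of `zEns` at mesh `δ` of the translated configuration are the loops translated by `δw`.** -/
theorem loops_zEns_relabel_shift (δ : ℝ) (w : Site 2) (ω : BondConfig (Site 2)) :
    (zEns.X δ (BondConfig.relabel τ[w] ω)).loops =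
      UnbasedLoop.map T[meshPoint δ w] (isometry_translate (meshPoint δ w)) '' (zEns.X δ ω).loops := by
  change (bondLoopConfig δ 0 _).loops = UnbasedLoop.map _ _ '' (bondLoopConfig δ 0 ω).loops
  rw [bondLoopConfig_relabel_shift, loops_map]

/-- Translating loops by `b` is injective (translate back by `−b`). -/
theorem map_translate_injective (b : ℂ) : Function.Injective (UnbasedLoop.map T[b] (isometry_translate b)) :=
  fun u v h ↦ by
    rw [← map_translate_map_translate_neg u b, ← map_translate_map_translate_neg v b]
    exact congrArg (UnbasedLoop.map T[-b] (isometry_translate (-b))) h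

/-! ## §4 Translations preserve `P_{1/2}`: the loop law of `zEns` is translation invariant -/

/-- **`ω ↦ ω + w` preserves `zEns.P = P_{1/2}`** (`bondPercolation_map_shift`). -/
theorem measurePreserving_relabel_shift_zEns (w : Site 2) : MeasurePreserving (BondConfig.relabel τ[w]) zEns.P zEns.P :=
  ⟨(BondConfig.relabel _).measurable, bondPercolation_map_shift w half⟩

/-- Change of variables: `∫ F(ω + w) dP = ∫ F dP` for EVERY real `F` (no measurability needed). -/
theorem integral_comp_relabel_shift_zEns (w : Site 2) (F : BondConfig (Site 2) → ℝ) :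
    ∫ ω, F (BondConfig.relabel τ[w] ω) ∂zEns.P = ∫ ω, F ω ∂zEns.P :=
  (measurePreserving_relabel_shift_zEns w).integral_comp' F

/-- **The law of the loop set of `zEns` is invariant under lattice translations**: for every mesh `δ`,
`w ∈ ℤ²` and EVERY real statistic `G` of a set of loops, `∫ G((· + δw) '' loops(X_δ ω)) dP = ∫ G(loops(X_δ ω)) dP`. -/
theorem integral_comp_translate_loops_zEns (δ : ℝ) (w : Site 2) (G : Set (UnbasedLoop ℂ) → ℝ) :
    ∫ ω, G (UnbasedLoop.map T[meshPoint δ w] (isometry_translate (meshPoint δ w)) ''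
        (zEns.X δ ω).loops) ∂zEns.P = ∫ ω, G (zEns.X δ ω).loops ∂zEns.P := by
  rw [← integral_comp_relabel_shift_zEns w fun ω ↦ G (zEns.X δ ω).loops]
  simp only [loops_zEns_relabel_shift]

/-! ## §5 Consequences: tower counts and dipole counts at translated centres -/

/-- Cutting a translated family of loops by a predicate = translating the family cut by the
translated predicate; with an injective translation the counts agree. -/
theorem ncard_sep_image_translate (b : ℂ) (L : Set (UnbasedLoop ℂ)) (Q Q' : UnbasedLoop ℂ → Prop)
    (hQ : ∀ u, Q (UnbasedLoop.map T[b] (isometry_translate b) u) ↔ Q' u) :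
    {u ∈ UnbasedLoop.map T[b] (isometry_translate b) '' L | Q u}.ncard = {u ∈ L | Q' u}.ncard := by
  have h : {u ∈ UnbasedLoop.map T[b] (isometry_translate b) '' L | Q u} =
      UnbasedLoop.map T[b] (isometry_translate b) '' {u ∈ L | Q' u} := by
    ext u
    exact ⟨fun ⟨⟨v, hv, hv'⟩, hq⟩ ↦ ⟨v, ⟨hv, (hQ v).1 (hv' ▸ hq)⟩, hv'⟩,
      fun ⟨v, ⟨hv, hq⟩, hv'⟩ ↦ ⟨⟨v, hv, hv'⟩, hv' ▸ (hQ v).2 hq⟩⟩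
  rw [h, Set.ncard_image_of_injective _ (map_translate_injective b)]

/-- The winding interior of the translated loop contains the translated ball iff the interior
contains the ball; the translated trace lies in the translated ball iff the trace lies in the ball. -/
theorem tower_pred_translate_iff (b x : ℂ) (ρ R : ℝ) (u : UnbasedLoop ℂ) :
    (closedBall (x + b) ρ ⊆ {z | (UnbasedLoop.map T[b] (isometry_translate b) u).wind z ≠ 0} ∧
        (UnbasedLoop.map T[b] (isometry_translate b) u).range ⊆ ball (x + b) R) ↔
      (closedBall x ρ ⊆ {z | u.wind z ≠ 0} ∧ u.range ⊆ ball x R) := by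
  refine and_congr ⟨fun h z hz ↦ ?_, fun h z hz ↦ ?_⟩ ⟨fun h z hz ↦ ?_, fun h z hz ↦ ?_⟩
  · have hz' : z + b ∈ closedBall (x + b) ρ := by simpa [mem_closedBall, dist_eq_norm] using hz
    simpa only [Set.mem_setOf_eq, wind_map_translate] using h hz'
  · have hz' : z - b ∈ closedBall x ρ := by
      rw [mem_closedBall, dist_eq_norm] at hz ⊢; simpa [sub_sub, add_comm b x] using hz
    have := h hz'
    rwa [Set.mem_setOf_eq, ← wind_map_translate u b (z - b), sub_add_cancel] at this
  · have hz' : z + b ∈ (UnbasedLoop.map T[b] (isometry_translate b) u).range := by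
      rw [range_map_translate]; exact ⟨z, hz, rfl⟩
    simpa [mem_ball, dist_eq_norm] using h hz'
  · rw [range_map_translate] at hz
    obtain ⟨y, hy, rfl⟩ := hz
    simpa [mem_ball, dist_eq_norm] using h hy

/-- **Tower counts at translated centres**: pathwise, `N_{x + b}(ρ, R)(loops + b) = N_x(ρ, R)(loops)`. -/
theorem towerCount_map_translate (b x : ℂ) (ρ R : ℝ) (c : LoopConfig ℂ) :
    towerCount (c.map T[b] (isometry_translate b)) (x + b) ρ R = towerCount c x ρ R := by
  unfold towerCount; rw [loops_map]
  exact ncard_sep_image_translate b c.loops _ _ fun u ↦ tower_pred_translate_iff b x ρ R u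

/-- **The law of the tower count of `zEns` is the same at every lattice translate of the centre**
(in expectation of any function `φ` of the count): `E φ(N_{x+δw}(ρ,R)) = E φ(N_x(ρ,R))`. -/
theorem integral_comp_towerCount_translate_zEns (δ : ℝ) (w : Site 2) (x : ℂ) (ρ R : ℝ) (φ : ℕ → ℝ) :
    ∫ ω, φ (towerCount (zEns.X δ ω) (x + meshPoint δ w) ρ R) ∂zEns.P =
      ∫ ω, φ (towerCount (zEns.X δ ω) x ρ R) ∂zEns.P := by
  rw [← integral_comp_relabel_shift_zEns w fun ω ↦ φ (towerCount (zEns.X δ ω) (x + meshPoint δ w) ρ R)]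
  refine integral_congr_ae (Eventually.of_forall fun ω ↦ ?_)
  change φ (towerCount (bondLoopConfig δ 0 _) _ ρ R) = φ (towerCount (bondLoopConfig δ 0 ω) x ρ R)
  rw [bondLoopConfig_relabel_shift, towerCount_map_translate]

/-- **Dipole counts at translated sites**: pathwise, the number of translated loops winding around
`x + b` and not around `y + b` is the number of loops winding around `x` and not around `y`. -/
theorem ncard_dipole_map_translate (b x y : ℂ) (L : Set (UnbasedLoop ℂ)) :
    {u ∈ UnbasedLoop.map T[b] (isometry_translate b) '' L | u.wind (x + b) ≠ 0 ∧ u.wind (y + b) = 0}.ncard =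
      {u ∈ L | u.wind x ≠ 0 ∧ u.wind y = 0}.ncard :=
  ncard_sep_image_translate b L _ _ fun u ↦ by rw [wind_map_translate, wind_map_translate]

/-- **The mean dipole counts of `zEns` are invariant under lattice translations**:
`E #{u : W(u, x+δw) ≠ 0, W(u, y+δw) = 0} = E #{u : W(u, x) ≠ 0, W(u, y) = 0}` — the honest form of
"the mean nesting-count field of `ℤ²` is `δℤ²`-periodic" (nesting counts themselves are infinite at
criticality; their differences along a segment are these finite dipole counts). -/
theorem integral_ncard_dipole_translate_zEns (δ : ℝ) (w : Site 2) (x y : ℂ) :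
    ∫ ω, ({u ∈ (zEns.X δ ω).loops | u.wind (x + meshPoint δ w) ≠ 0 ∧
        u.wind (y + meshPoint δ w) = 0}.ncard : ℝ) ∂zEns.P =
      ∫ ω, ({u ∈ (zEns.X δ ω).loops | u.wind x ≠ 0 ∧ u.wind y = 0}.ncard : ℝ) ∂zEns.P := by
  rw [← integral_comp_relabel_shift_zEns w fun ω ↦ ({u ∈ (zEns.X δ ω).loops |
    u.wind (x + meshPoint δ w) ≠ 0 ∧ u.wind (y + meshPoint δ w) = 0}.ncard : ℝ)]
  refine integral_congr_ae (Eventually.of_forall fun ω ↦ ?_)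
  simp only [loops_zEns_relabel_shift, ncard_dipole_map_translate]

end BondTranslation

end Summit.CriticalPhenomena.CardyFormulaZ2.Cruxes.NestingRigidity.RingCloudTomography

end
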